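import Literature.Computability.QuantumComplexity.GluedTreesThm9Graph
import Literature.Computability.Cryptography.IndistinguishabilityObfuscator
import Literature.Computability.Cryptography.PuncturablePRF
import Literature.Computability.Complexity.CodeFPArith
import Literature.Computability.Complexity.CodeFPLists
import Literature.Computability.Complexity.CodeFPStringKit
import Literature.Computability.Complexity.CodeFPStrings
import HarnessLib

/-!
# The obfuscated glued-trees instance generator (white-box glued trees)

Topic `Literature/Computability/Cryptography`. Definition item `defn-obfuscatedGluedTreesGen-2`
(route `Summits/QuantumAdvantage/QuantumAdvantage/Theses/WhiteBoxWalk`: crux `WbwObfuscatedGluedTrees`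
= stmt-QuantumAdvantage-2340, supports `WbwSuccinctWalk` stmt-2360 and the glue `WbwWitnessGlue`
stmt-14785), the RE-REQUEST after proposal p45303 was bounced `revise`; this file follows the
reviewer's fixes: it is BUILT ON the landed glued-trees vocabulary
`Literature/Computability/QuantumComplexity/GluedTrees.lean` (`GluedTrees.Vertex d`, `CycleDatum d`,
`graph d σ`, `entrance`/`exit`, `nbrNames`, `gluedTreesOracle σ ν`, `nameVal`/`nameOfVal`) — no
second glued-trees graph, no standalone entrance/exit, no re-declared list join —, and the depth is an
explicit positive schedule `Λ.depth`.

## The object (what is defined)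

Write `n = |s|` for the seed length.  A parameter record `Λ : Params` fixes the schedules
`d = Λ.depth n > 0` (tree depth), `μ = Λ.prfParam n` (the security parameter at which the
LENGTH-PRESERVING puncturable PRF `P` is run), `Λ.keyPartLen n` (length of each of four keys),
`κ = Λ.secParam n` (security parameter of the obfuscator `O`), `Λ.coinLen n` (the obfuscator's coin
count — a COMPUTABLE schedule, see below) and a circuit presentation `Λ.circ n K` of the neighbour
predicate.  From `O : CircuitObfuscator`, `P : PuncturablePRFScheme` and `Λ`:

* §2 `label d v ∈ {0,1}^{2d+3}` — the public injective code of a vertex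
  `v = (side, depth j, position i)` of `G'_d` (`label_injective`).
* §3 NAMES = deterministic authenticated encryption of the labels from the PRF (SIV / "MAC the
  plaintext, use the tag as IV": `sivEnc`): `name_k(v) = τ ++ (label v ⊕ F_{k₂}(τ))`,
  `τ = F_{k₁}(label v)`, all PRF values fitted to their nominal lengths (`prf`), so that the
  construction is well formed and `name_k` is INJECTIVE for every scheme and every key
  (`vname_injective`); the naming is the embedding `naming : Vertex d ↪ {0,1}^N`,
  `N = μ + 2d + 3`, that the tree's oracle takes; recognition `unname` has ONE rejection symbol for
  every string that is not an honest name (`unname_eq_some_iff`, `unname_eq_none_iff`: integrity is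
  by recomputation of the tag; no side/level/depth field is readable off a name).
* §4 the alternating CYCLE `σ_k : CycleDatum d` = two keyed pseudorandom permutations of the leaf
  positions `Fin 2^d`: four-round Feistel networks on `{0,1}^d` with PRF round functions
  (`feistelRound`, involutive for every round function, hence `prp : Equiv.Perm`; transported by
  `bitVecEquiv : {0,1}^d ≃ Fin 2^d`), keys `k₃, k₄` — never a structured cycle.
* §5 the NEIGHBOUR PREDICATE `N_k` (`nbrBit`): on `2N` inputs `(a, b)` it returns bit `nameVal b` of
  the answer string `answerBits σ ν a` = `2`-bit neighbour count ++ the neighbour names of the vertex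
  named `a` IN THE CANONICAL SORTED ORDER of the tree's `gluedTreesOracle σ ν a` (role order is
  refuted: `Theorems/WbwObfuscatedGluedTrees/Negative/LoadBearing.lean` §1), zero-padded to
  `ansLen N = 3N + 2`, the all-invalid answer for strings naming no vertex; `decodeAnswer` reads the
  list back (`decodeAnswer_answerBits`, using `length_gluedTreesOracle_le`: degrees are `≤ 3`).
  One single-output circuit with position inputs is the bitwise reading of "the circuit mapping a
  name to the sorted list of its `≤ 3` neighbour names" and is the shape `Circuit (Fin m)` of the
  route's line skeleton `Lines/knowledge_of_walk_split.lean` (`genObf`).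
* §6 the GENERATOR: the seed `s ∈ {0,1}ⁿ` is cut into the key material
  `K = s.take (4 · keyPartLen n)` (keys `kᵢ = Λ.key n K i`) and the obfuscator's coins
  `r = (s.drop (4 · keyPartLen n)).take (coinLen n)`; the instance is
  `gen s = ⟨encodeSizedCircuit ⟨2N, O.obf κ (Λ.circ n K) r⟩, name_K(ENTRANCE)⟩` (`boolPair`), the
  planted answer `ans s = name_K(EXIT)` zero-padded to `|gen s|` (`length_ans`, `ans_eq`,
  `exitName_prefix_ans`, `setOf_ans_prefix_subset`, `ans_ne_nil` — the `ans = []` trap of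
  `Negative/TypedTraps.lean` is excluded on EVERY seed of EVERY length, and every seed of every
  length is used: short seeds just give short keys), and
  `obfuscatedGluedTreesGen Λ : CircuitObfuscator → PuncturablePRFScheme → (f) → (c) → (gen, ans)` in
  the argument order of the route's `GenType` (`Negative/LoadBearing.lean` §0).
* §7 FUNCTIONALITY: `CircCorrect Λ P` (the presentation computes `N_K`; non-vacuous:
  `circCorrect_canonical` via the tabulating one-gate circuit `truthTableCircuit`),
  `ObfPreservesAt Λ O s` (functionality of `O` at the instance — a HYPOTHESIS, obtained from the
  tree's `PreservesFunctionality` by `obfPreservesAt_of_preservesFunctionality`), and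
  `eval_instCircuit`: under both, the circuit shipped in `gen s`, queried at `(a, b)`, returns bit
  `nameVal b` of `answerBits σ_K ν_K a` — the adjacency of `GluedTrees.graph d σ_K` transported by
  the naming `ν_K` (an embedding, i.e. a graph isomorphism onto its image), in canonical order.
* §8 POLYNOMIAL TIME: `FPData Λ O P` collects the typed `CodeFP` data — the schedules in unary, the
  circuit presentation on `⟨1ⁿ, K⟩`, the PRF evaluation map on `⟨1^μ, ⟨k, x⟩⟩` (the code used by
  `IsEfficientFamily`) and the obfuscator's run map on `⟨⟨1^κ, code C⟩, r⟩` (the code used by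
  `CircuitObfuscator.IsEfficient`) — and `FPData.polyTimeComputable_gen` assembles
  `PolyTimeComputable id id (gen Λ O P)` (the first conjunct of `WbwThesis`) from it with the tree's
  `CodeFP` algebra (`strTake`, `strDrop`, `strAppend`, `bitsToStr`, `replicateOf`, `unMulConst`, …).

## Design notes (typing obligations of the route honoured)

* (T1) the primitives are FED to the generator (`GenType` order); the injective one-way `f` and
  the exponent `c` are accepted and unused by the OBJECT — they enter BPR15's security hybrids and
  the route's choice of the schedules in `Λ`, not the construction.
* (T8) `gen ∈ FP` needs a COMPUTABLE coin budget: `O.coins κ C = O.coinLen |code|` is only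
  polynomially bounded under `O.IsEfficient`, so the coins handed to `O` are a seed segment of the
  scheduled length `Λ.coinLen n` (intended `= O.coins κ N_K ≤ n − 4·keyPartLen n`, the line's coin
  discipline; then the law of the code given `K` is `O.obfCodePMF κ N_K`).
* Circuit presentation as a datum: the tree's `PuncturablePRFScheme` provides FUNCTIONS, not
  circuits, and single-output `Circuit`s are what obfuscators take; the presentation `Λ.circ` with
  the correctness predicate `CircCorrect` (and whatever size bound the consumer needs for membership
  in `ppolyCircuits κ`) is therefore a parameter, exactly like the key-indexed family `C` of the
  line's `genObf`. `CircCorrect` is non-vacuous (`circCorrect_canonical`, exponential size); an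
  efficient presentation follows from `P.IsEfficient` by the route's circuit-simulation tools.
* Lengths are total: every PRF value is fitted (`fit`) to its nominal length, so names have length
  exactly `N`, the naming is injective and decryption is correct for EVERY `P` and key (the PRF's
  pseudorandomness is used by the crux, never by this file); keys are raw seed segments (for
  `4·keyPartLen n = 4·P.keyLen μ ≤ n` they are uniform well-formed keys).
* Specification-level decoders (`unname`, via `Classical.choice` over the finite vertex set) define
  the FUNCTION `N_K`; its efficient computation is the presentation's job.
* What is NOT here: any hardness statement (iO security, PRF security, one-wayness are hypotheses of
  the crux), the quantum walk (clause (Q): `ChildsEtAl2003_thm3` over the same `GluedTrees.graph`),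
  and the conversion `PolyTimeComputable → CodeFP` of the primitives' efficiency predicates (clocked
  total extensions; route toolkit `WbwObfuscatedGluedTreesKowFPExtension`).

## References

* [ChildsEtAl2003] A. M. Childs et al., *Exponential algorithmic speedup by a quantum walk*, STOC
  2003, §2 (the graphs `G'_n`, names, the oracle), §4 Game 1.
* [BitanskyPanethRosen2015] N. Bitansky, O. Paneth, A. Rosen, *On the cryptographic hardness of
  finding a Nash equilibrium*, FOCS 2015, §5.2–5.3 (sampling hard instances: PRF keys, obfuscated
  successor program; the template this generator instantiates on glued trees).
* [Goldreich2004FoC2] O. Goldreich, *Foundations of Cryptography II*, CUP 2004, Construction 5.3.9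
  (PRF-based private-key encryption), Construction 5.4.19 / §5.4.3 (MAC-then-encrypt, authenticated
  private-key schemes).
* [LubyRackoff1988] M. Luby, C. Rackoff, *How to construct pseudorandom permutations from
  pseudorandom functions*, SIAM J. Comput. 17 (1988) (Feistel networks with PRF round functions).
* [BarakEtAl2012] B. Barak et al., *On the (im)possibility of obfuscating programs*, J. ACM 59
  (2012), Def. 2.2 (functionality of an obfuscator).
* [AroraBarak2009] S. Arora, B. Barak, *Computational Complexity*, CUP 2009, §1.3 (closure of
  polynomial time), §6.1 (circuits).
-/

noncomputable section

namespace Literature.Computability.Cryptography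

open Literature.Computability.Complexity Literature.Computability.QuantumComplexity
open _root_.Computability

namespace ObfuscatedGluedTrees

/-! ## §1 Bit strings: fitting to a length, bitwise xor, binary expansions -/

/-- `fit m x`: the string `x` cut or zero-padded to length EXACTLY `m`. [folklore] -/
def fit (m : ℕ) (x : List Bool) : List Bool := (x ++ List.replicate m false).take m

/-- `fit m x` has length `m`. [folklore] -/
@[simp] theorem length_fit (m : ℕ) (x : List Bool) : (fit m x).length = m := by
  simp [fit]

/-- A string of length `m` is fixed by `fit m`. [folklore] -/
theorem fit_of_length_eq {m : ℕ} {x : List Bool} (h : x.length = m) : fit m x = x := by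
  simp [fit, ← h]

/-- `fit m x = x ++ 0^{m - |x|}` when `|x| ≤ m`. [folklore] -/
theorem fit_eq_append_of_le {m : ℕ} {x : List Bool} (h : x.length ≤ m) :
    fit m x = x ++ List.replicate (m - x.length) false := by
  rw [fit, List.take_append, List.take_of_length_le h, List.take_replicate, min_eq_left (Nat.sub_le _ _)]

/-- Bitwise exclusive or of two strings (truncated to the shorter one). [folklore] -/
def bxor (x y : List Bool) : List Bool := List.zipWith (fun a b => xor a b) x y

/-- `|x ⊕ y| = min |x| |y|`. [folklore] -/
@[simp] theorem length_bxor (x y : List Bool) : (bxor x y).length = min x.length y.length := by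
  simp [bxor]

/-- Masking twice with the same mask of the same length is the identity. [folklore] -/
theorem bxor_bxor_of_length_eq {x y : List Bool} (h : y.length = x.length) : bxor (bxor x y) y = x := by
  induction x generalizing y with
  | nil => simp [bxor]
  | cons a x ih =>
    cases y with
    | nil => simp at h
    | cons b y =>
      simp only [List.length_cons, Nat.add_right_cancel_iff] at h
      simp only [bxor, List.zipWith_cons_cons] at ih ⊢
      rw [ih h, Bool.xor_assoc, Bool.xor_self, Bool.xor_false]

/-- Masking is injective for masks at least as long as the strings. [folklore] -/
theorem bxor_left_injective {x x' y : List Bool} (hx : x.length = y.length) (hx' : x'.length = y.length)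
    (h : bxor x y = bxor x' y) : x = x' := by
  rw [← bxor_bxor_of_length_eq hx.symm, h, bxor_bxor_of_length_eq hx'.symm]

/-- The `w` low-order bits of `m` (bit `t` = `m.testBit t`). [folklore] -/
def bitsOf (w m : ℕ) : List Bool := List.ofFn fun t : Fin w => m.testBit t

/-- `bitsOf w m` has length `w`. [folklore] -/
@[simp] theorem length_bitsOf (w m : ℕ) : (bitsOf w m).length = w := by simp [bitsOf]

/-- Numbers below `2^w` are determined by their `w` low-order bits. [folklore] -/
theorem bitsOf_injOn (w : ℕ) {m m' : ℕ} (hm : m < 2 ^ w) (hm' : m' < 2 ^ w)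
    (h : bitsOf w m = bitsOf w m') : m = m' := by
  apply Nat.eq_of_testBit_eq
  intro t
  by_cases ht : t < w
  · have := congrArg (fun l => l.getD t false) h
    simpa [bitsOf, List.getD_eq_getElem?_getD, ht] using this
  · push Not at ht
    rw [Nat.testBit_lt_two_pow (lt_of_lt_of_le hm (Nat.pow_le_pow_right two_pos ht)),
      Nat.testBit_lt_two_pow (lt_of_lt_of_le hm' (Nat.pow_le_pow_right two_pos ht))]

/-! ## §2 Labels of the vertices of `G'_d` -/

open GluedTrees

variable {d : ℕ}

/-- The length `2d + 3` of a vertex label at depth parameter `d`. [folklore] -/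
def labelLen (d : ℕ) : ℕ := 2 * d + 3

/-- The **label** of a vertex `(side, depth j ≤ d, position i < 2ʲ)` of `G'_d`: the side bit, then
`j` and `i` in binary on `d + 1` bits each — a public, injective, fixed-length code of the vertex
set of `GluedTrees.graph d σ` (the plaintext that the naming encrypts). [cite: ChildsEtAl2003, §2] -/
def label (d : ℕ) (v : Vertex d) : List Bool :=
  v.1 :: (bitsOf (d + 1) v.2.1 ++ bitsOf (d + 1) v.2.2)

/-- Labels have length `labelLen d = 2d + 3`. [folklore] -/
@[simp] theorem length_label (v : Vertex d) : (label d v).length = labelLen d := by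
  simp [label, labelLen]; ring

/-- The label code is injective. [folklore] -/
theorem label_injective (d : ℕ) : Function.Injective (label d) := by
  rintro ⟨b, j, i⟩ ⟨b', j', i'⟩ h
  simp only [label, List.cons.injEq] at h
  obtain ⟨rfl, h⟩ := h
  obtain ⟨hj, hi⟩ := List.append_inj h (by simp)
  have hjj : (j : ℕ) = j' :=
    bitsOf_injOn (d + 1) (j.isLt.trans Nat.lt_two_pow_self) (j'.isLt.trans Nat.lt_two_pow_self) hj
  obtain rfl : j = j' := Fin.ext hjj
  have hii : (i : ℕ) = i' :=
    bitsOf_injOn (d + 1) (lt_of_lt_of_le i.isLt (Nat.pow_le_pow_right two_pos (by omega)))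
      (lt_of_lt_of_le i'.isLt (Nat.pow_le_pow_right two_pos (by omega))) hi
  obtain rfl : i = i' := Fin.ext hii
  rfl

/-! ## §3 Names: deterministic authenticated encryption of the labels from the PRF (SIV) -/

section Naming

variable (P : PuncturablePRFScheme)

/-- The PRF of `P` at security parameter `μ` with key `k`, its input fitted to `μ` bits and its
output fitted to `m` bits (`P` is meant to be length-preserving at `μ`, `inLen μ = outLen μ = μ`;
the fitting gives every value a definite length whatever the scheme does off its length
discipline, so that the construction is well formed for EVERY `P`). [folklore] -/
def prf (μ : ℕ) (k : List Bool) (m : ℕ) (x : List Bool) : List Bool := fit m (P.eval μ k (fit μ x))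

/-- `prf` values have the requested length. [folklore] -/
@[simp] theorem length_prf (μ : ℕ) (k : List Bool) (m : ℕ) (x : List Bool) :
    (prf P μ k m x).length = m :=
  length_fit _ _

/-- The synthetic IV / authentication tag of a plaintext `x`: `τ = F_{k₁}(x) ∈ {0,1}^μ`.
[cite: Goldreich2004FoC2, Construction 5.4.19 (MAC then encrypt with a PRF)] -/
def tag (μ : ℕ) (k₁ : List Bool) (x : List Bool) : List Bool := prf P μ k₁ μ x

/-- Tags have length `μ`. [folklore] -/
@[simp] theorem length_tag (μ : ℕ) (k₁ : List Bool) (x : List Bool) : (tag P μ k₁ x).length = μ :=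
  length_prf _ _ _ _ _

/-- **Deterministic authenticated encryption from the PRF** (SIV: the tag is the IV of a PRF
stream cipher): `Enc_{k₁,k₂}(x) = τ ++ (x ⊕ F_{k₂}(τ))`, `τ = F_{k₁}(x)`. Decryption recomputes
`x = c ⊕ F_{k₂}(τ)` and ACCEPTS iff `F_{k₁}(x) = τ` (ciphertext integrity: every string that is not
an honest ciphertext is rejected, cf. `unname`). [cite: Goldreich2004FoC2, Constructions 5.3.9 and 5.4.19] -/
def sivEnc (μ : ℕ) (k₁ k₂ : List Bool) (x : List Bool) : List Bool :=
  tag P μ k₁ x ++ bxor x (prf P μ k₂ x.length (tag P μ k₁ x))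

/-- `|Enc(x)| = μ + |x|`. [folklore] -/
@[simp] theorem length_sivEnc (μ : ℕ) (k₁ k₂ : List Bool) (x : List Bool) :
    (sivEnc P μ k₁ k₂ x).length = μ + x.length := by
  simp [sivEnc]

/-- `Enc` is injective on plaintexts of a given length, for EVERY scheme and EVERY key pair (the
tag travels with the ciphertext, and masking by a fixed mask is injective). [folklore] -/
theorem sivEnc_injective_of_length_eq {μ : ℕ} {k₁ k₂ : List Bool} {x x' : List Bool}
    (hl : x.length = x'.length) (h : sivEnc P μ k₁ k₂ x = sivEnc P μ k₁ k₂ x') : x = x' := by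
  unfold sivEnc at h
  obtain ⟨ht, hc⟩ := List.append_inj h (by simp)
  rw [ht, hl] at hc
  exact bxor_left_injective (by simp [hl]) (by simp) hc

variable (μ : ℕ) (k₁ k₂ : List Bool) (d : ℕ)

/-- The common length `N = μ + (2d + 3)` of the vertex names. [folklore] -/
def nameLen (μ d : ℕ) : ℕ := μ + labelLen d

/-- **The name of a vertex**: `name_k(v) = Enc_{k₁,k₂}(label v) ∈ {0,1}^N` — a pseudorandom-looking
string carrying no readable side / depth / position (the label travels masked by `F_{k₂}(τ)`).
[cite: ChildsEtAl2003, §2 ("each vertex is given a distinct name")] -/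
def vname (v : Vertex d) : List Bool := sivEnc P μ k₁ k₂ (label d v)

/-- Names have length `nameLen μ d`. [folklore] -/
@[simp] theorem length_vname (v : Vertex d) : (vname P μ k₁ k₂ d v).length = nameLen μ d := by
  simp [vname, nameLen]

/-- Distinct vertices have distinct names (for every scheme and every key). [folklore] -/
theorem vname_injective : Function.Injective (vname P μ k₁ k₂ d) := fun v w h =>
  label_injective d (sivEnc_injective_of_length_eq P (by simp) h)

/-- **The naming** `ν_k : V(G'_d) ↪ {0,1}^N` as an embedding into bit vectors — the datum the
tree's oracle `gluedTreesOracle σ ν` takes. [cite: ChildsEtAl2003, §2] -/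
def naming : Vertex d ↪ (Fin (nameLen μ d) → Bool) where
  toFun v i := (vname P μ k₁ k₂ d v).get (i.cast (length_vname P μ k₁ k₂ d v).symm)
  inj' v w h := by
    apply vname_injective P μ k₁ k₂ d
    refine List.ext_get (by simp) fun i h₁ h₂ => ?_
    have := congrFun h ⟨i, by simpa using h₁⟩
    simpa using this

/-- The bit vector `ν_k(v)` lists back to the name string `name_k(v)`. [folklore] -/
theorem ofFn_naming (v : Vertex d) : List.ofFn (naming P μ k₁ k₂ d v) = vname P μ k₁ k₂ d v := by
  apply List.ext_get (by simp) fun i h₁ h₂ => ?_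
  simp only [List.get_eq_getElem, List.getElem_ofFn]
  rfl

open Classical in
/-- **Decryption / recognition of names** (specification): the vertex named by `y`, or the ONE
rejection symbol `none` for every string that is not an honest name (wrong length, wrong tag,
non-canonical label: all rejected alike — ciphertext integrity). [cite: Goldreich2004FoC2, Construction 5.4.19] -/
def unname (y : List Bool) : Option (Vertex d) :=
  if h : ∃ v, vname P μ k₁ k₂ d v = y then some h.choose else none

/-- Honest names are recognised. [folklore] -/
theorem unname_eq_some_iff (y : List Bool) (v : Vertex d) :
    unname P μ k₁ k₂ d y = some v ↔ vname P μ k₁ k₂ d v = y := by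
  classical
  unfold unname
  split_ifs with h
  · rw [Option.some.injEq]
    constructor
    · rintro rfl; exact h.choose_spec
    · intro hv; exact vname_injective P μ k₁ k₂ d (h.choose_spec.trans hv.symm)
  · simp only [false_iff]
    exact fun hv => h ⟨v, hv⟩

/-- `unname (name v) = v`. [folklore] -/
@[simp] theorem unname_vname (v : Vertex d) : unname P μ k₁ k₂ d (vname P μ k₁ k₂ d v) = some v :=
  (unname_eq_some_iff P μ k₁ k₂ d _ v).2 rfl

/-- Everything that is not an honest name is rejected. [folklore] -/
theorem unname_eq_none_iff (y : List Bool) :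
    unname P μ k₁ k₂ d y = none ↔ ∀ v, vname P μ k₁ k₂ d v ≠ y := by
  classical
  unfold unname
  split_ifs with h
  · simp only [false_iff, not_forall, not_not]; exact h
  · simp only [true_iff]; exact fun v hv => h ⟨v, hv⟩

end Naming

/-! ## §4 The pseudorandom alternating cycle: a keyed Feistel permutation of `{0,1}^d` -/

section Cycle

variable {d : ℕ}

/-- One (unbalanced) Feistel round on bit vectors: the positions in `S` are xored with a
function `F` of the vector with its `S`-positions blanked. [cite: LubyRackoff1988, main construction] -/
def feistelRound (S : Fin d → Bool) (F : (Fin d → Bool) → (Fin d → Bool)) (w : Fin d → Bool) :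
    Fin d → Bool :=
  fun i => if S i then xor (w i) (F (fun j => if S j then false else w j) i) else w i

/-- A Feistel round is an involution (the blanked vector is unchanged by the round). [folklore] -/
theorem feistelRound_involutive (S : Fin d → Bool) (F : (Fin d → Bool) → (Fin d → Bool)) :
    Function.Involutive (feistelRound S F) := by
  intro w
  have hb : (fun j => if S j then false else feistelRound S F w j) =
      fun j => if S j then false else w j := by
    funext j
    by_cases hj : S j <;> simp [feistelRound, hj]
  funext i
  by_cases hi : S i
  · have h1 : feistelRound S F (feistelRound S F w) i =
        xor (feistelRound S F w i) (F (fun j => if S j then false else feistelRound S F w j) i) := by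
      simp [feistelRound, hi]
    have h2 : feistelRound S F w i = xor (w i) (F (fun j => if S j then false else w j) i) := by
      simp [feistelRound, hi]
    rw [h1, hb, h2, Bool.xor_assoc, Bool.xor_self, Bool.xor_false]
  · simp [feistelRound, hi]

/-- A Feistel round as a permutation of `{0,1}^d`. [cite: LubyRackoff1988, main construction] -/
def feistelPerm (S : Fin d → Bool) (F : (Fin d → Bool) → (Fin d → Bool)) : Equiv.Perm (Fin d → Bool) :=
  (feistelRound_involutive S F).toPerm _

/-- Applying the permutation is applying the round. [folklore] -/
@[simp] theorem feistelPerm_apply (S : Fin d → Bool) (F : (Fin d → Bool) → (Fin d → Bool))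
    (w : Fin d → Bool) : feistelPerm S F w = feistelRound S F w := rfl

/-- The round functions `F_r(y) = F_k(⟨r⟩₈ ++ y)` read off the PRF (round index domain-separated).
[cite: LubyRackoff1988, main construction] -/
def roundFn (P : PuncturablePRFScheme) (μ : ℕ) (k : List Bool) (d : ℕ) (r : ℕ) (y : Fin d → Bool) :
    Fin d → Bool :=
  fun i => (prf P μ k d (bitsOf 8 r ++ List.ofFn y)).getD i false

/-- The lower half of the positions. [folklore] -/
def lowHalf (d : ℕ) : Fin d → Bool := fun i => decide ((i : ℕ) < d / 2)

/-- The upper half of the positions. [folklore] -/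
def highHalf (d : ℕ) : Fin d → Bool := fun i => decide (d / 2 ≤ (i : ℕ))

/-- **The keyed pseudorandom permutation of `{0,1}^d`**: four Feistel rounds with PRF round
functions, alternating halves (Luby–Rackoff). A permutation for EVERY key; pseudorandom when `F_k`
is. [cite: LubyRackoff1988, main construction] -/
def prp (P : PuncturablePRFScheme) (μ : ℕ) (k : List Bool) (d : ℕ) : Equiv.Perm (Fin d → Bool) :=
  (((feistelPerm (lowHalf d) (roundFn P μ k d 0)).trans (feistelPerm (highHalf d) (roundFn P μ k d 1))).trans
    (feistelPerm (lowHalf d) (roundFn P μ k d 2))).trans (feistelPerm (highHalf d) (roundFn P μ k d 3))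

/-- Bit vectors of length `d` ≃ `Fin 2^d` (Mathlib's `finFunctionFinEquiv`, bit `i` of weight `2ⁱ`).
[folklore] -/
def bitVecEquiv (d : ℕ) : (Fin d → Bool) ≃ Fin (2 ^ d) :=
  ((Equiv.refl (Fin d)).arrowCongr finTwoEquiv.symm).trans finFunctionFinEquiv

/-- The keyed permutation transported to leaf positions `Fin 2^d`. [folklore] -/
def leafPerm (P : PuncturablePRFScheme) (μ : ℕ) (k : List Bool) (d : ℕ) : Equiv.Perm (Fin (2 ^ d)) :=
  (bitVecEquiv d).permCongr (prp P μ k d)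

/-- **The cycle datum `σ_k = (e, f)` of the instance**: the two leaf orders of the alternating
cycle are the keyed pseudorandom permutations under the two cycle keys `k₃, k₄` (a CycleDatum of the
tree's `GluedTrees.graph d`, never a structured cycle). [cite: ChildsEtAl2003, §2] -/
def cycleOf (P : PuncturablePRFScheme) (μ : ℕ) (k₃ k₄ : List Bool) (d : ℕ) : CycleDatum d :=
  (leafPerm P μ k₃ d, leafPerm P μ k₄ d)

end Cycle

/-! ## §5 The neighbour function `N_k` on names, one output bit at a time -/

section Neighbour

variable {d N : ℕ}

/-- The length `3N + 2` of a (padded) oracle answer: a `2`-bit neighbour count and three name slots.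
[folklore] -/
def ansLen (N : ℕ) : ℕ := 3 * N + 2

/-- **The oracle answer as a bit string**: for the queried name `a`, the number of neighbours
(`2` bits) followed by the neighbour names IN THE CANONICAL SORTED ORDER of the tree's
`gluedTreesOracle σ ν a` (increasing binary value — role order would leak the EXIT), zero-padded to
`ansLen N`; the all-invalid answer (`gluedTreesOracle = []`) for strings naming no vertex.
[cite: ChildsEtAl2003, §2 and §4 Game 1] -/
def answerBits (σ : CycleDatum d) (ν : Vertex d ↪ (Fin N → Bool)) (a : Fin N → Bool) : List Bool :=
  fit (ansLen N) (bitsOf 2 (gluedTreesOracle σ ν a).length ++ ((gluedTreesOracle σ ν a).map List.ofFn).flatten)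

/-- Answers have length `ansLen N`. [folklore] -/
@[simp] theorem length_answerBits (σ : CycleDatum d) (ν : Vertex d ↪ (Fin N → Bool)) (a : Fin N → Bool) :
    (answerBits σ ν a).length = ansLen N :=
  length_fit _ _

/-- **The neighbour predicate `N_k`** — the Boolean function the instance's circuit computes: on
`2N` inputs, the first `N` bits are a queried name `a`, the last `N` bits an output position `t`
in binary; the value is bit `t` of `answerBits σ ν a` (`false` past the end). One single-output
circuit with position inputs is the bitwise reading of "the circuit mapping a name to the sorted
list of its `≤ 3` neighbour names". [cite: ChildsEtAl2003, §2 and §4 Game 1] -/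
def nbrBit (σ : CycleDatum d) (ν : Vertex d ↪ (Fin N → Bool)) (x : Fin (N + N) → Bool) : Bool :=
  (answerBits σ ν fun i => x (Fin.castAdd N i)).getD (nameVal fun i => x (Fin.natAdd N i)) false

/-- A name names at most one vertex, which has at most three neighbours: the oracle lists at most
three names (`1 ≤ d`). [cite: ChildsEtAl2003, §2] -/
theorem length_gluedTreesOracle_le (hd : 1 ≤ d) (σ : CycleDatum d) (ν : Vertex d ↪ (Fin N → Bool))
    (a : Fin N → Bool) : (gluedTreesOracle σ ν a).length ≤ 3 := by
  unfold gluedTreesOracle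
  rw [List.length_map, Finset.length_sort]
  refine (Finset.card_image_le).trans ?_
  unfold nbrNames
  refine (Finset.card_biUnion_le).trans ?_
  have hsub : (Finset.univ.filter fun v => ν v = a).card ≤ 1 := by
    refine Finset.card_le_one.mpr fun v hv w hw => ?_
    simp only [Finset.mem_filter, Finset.mem_univ, true_and] at hv hw
    exact ν.injective (hv.trans hw.symm)
  rcases Finset.card_le_one.mp hsub |> fun h => (Finset.univ.filter fun v => ν v = a).eq_empty_or_nonempty with h0 | ⟨v, hv⟩
  · simp [h0]
  · have hs : (Finset.univ.filter fun v => ν v = a) = {v} :=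
      Finset.eq_singleton_iff_unique_mem.mpr ⟨hv, fun w hw => Finset.card_le_one.mp hsub w hw v hv⟩
    rw [hs, Finset.sum_singleton, Finset.card_map, SimpleGraph.card_neighborFinset_eq_degree,
      degree_eq hd]
    split_ifs <;> omega

end Neighbour

/-! ## §6 The generator: parameters, keys read off the seed, `gen` and `ans` -/

section Generator

/-- A one-gate circuit tabulating an arbitrary Boolean function of its `m` inputs (fan-in `m`, over
the full basis): the trivial witness that the neighbour predicate HAS a circuit presentation
(`circCorrect_canonical`); the efficient presentations are the route's business. [folklore] -/
def truthTableCircuit {m : ℕ} (f : (Fin m → Bool) → Bool) : Circuit (Fin m) where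
  gates := [⟨m, f, fun a => Sum.inl a⟩]
  output := Sum.inr 0
  wf j hj a m' h := by
    have hj0 : j = 0 := by simpa using hj
    subst hj0
    simp at h
  wf_output m' h := by
    simp only [Sum.inr.injEq] at h
    simp [← h]

/-- The one-gate circuit computes the tabulated function. [folklore] -/
@[simp] theorem eval_truthTableCircuit {m : ℕ} (f : (Fin m → Bool) → Bool) (x : Fin m → Bool) :
    (truthTableCircuit f).eval x = f x := by
  simp [truthTableCircuit, Circuit.eval, Circuit.wireVals]

/-- **Parameters of the obfuscated glued-trees generator** (everything the object needs besides the
obfuscator `O` and the PRF scheme `P`; all schedules are functions of the seed length `n = |s|`):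
* `depth n > 0` — the depth `d` of the two trees (`G'_d` has `2^{d+2} − 2` vertices; with a seed of
  `n` bits holding the keys, `d = ⌊n^{1/a}⌋`-type schedules keep `2^{d/6}` super-polynomial);
* `prfParam n = μ` — the security parameter at which `P` (length-preserving, `inLen = outLen = id`)
  is run: tags and masks have `μ` bits, names `μ + (2d+3)` bits;
* `keyPartLen n` — the length of each of the FOUR keys `k₁, k₂` (naming), `k₃, k₄` (cycle) cut off
  the seed (`4 · keyPartLen n ≤ n`; intended `= P.keyLen μ`);
* `secParam n = κ` — the security parameter handed to `O`;
* `coinLen n` — the number of seed bits handed to `O` as coins (a COMPUTABLE coin schedule: the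
  tree's `O.coins κ C = O.coinLen |code|` is only polynomially BOUNDED under `O.IsEfficient`, not
  computable, so `gen ∈ FP` needs the schedule as a datum; intended `= O.coins κ N_k ≤ n − 4·keyPartLen n`);
* `circ n K` — the CIRCUIT PRESENTATION of the neighbour predicate `N_k` on `2N` inputs for key
  material `K` (its correctness is the separate predicate `CircCorrect`, non-vacuous by
  `circCorrect_canonical`; its size/efficiency is the route's hypothesis, as for every circuit the
  obfuscator is fed).
No field is a hardness assumption. [cite: BitanskyPanethRosen2015, §5.2 (the obfuscated instance: keys, obfuscation coins, program)] -/
structure Params where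
  /-- Depth of the trees at seed length `n`. -/
  depth : ℕ → ℕ
  /-- The depth is positive. -/
  depth_pos : ∀ n, 0 < depth n
  /-- Security parameter of the PRF at seed length `n`. -/
  prfParam : ℕ → ℕ
  /-- Length of each of the four keys. -/
  keyPartLen : ℕ → ℕ
  /-- Security parameter of the obfuscator. -/
  secParam : ℕ → ℕ
  /-- Number of coins handed to the obfuscator. -/
  coinLen : ℕ → ℕ
  /-- Circuit presentation of the neighbour predicate for key material `K` at seed length `n`. -/
  circ : (n : ℕ) → List Bool →
    Circuit (Fin (nameLen (prfParam n) (depth n) + nameLen (prfParam n) (depth n)))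

variable (Λ : Params) (O : CircuitObfuscator) (P : PuncturablePRFScheme)

namespace Params

/-- The common name length `N(n) = μ + 2d + 3` at seed length `n`. [folklore] -/
abbrev N (n : ℕ) : ℕ := nameLen (Λ.prfParam n) (Λ.depth n)

/-- The key material: the first `4 · keyPartLen n` bits of the seed. [cite: BitanskyPanethRosen2015, §5.2] -/
def keyMaterial (s : List Bool) : List Bool := s.take (4 * Λ.keyPartLen s.length)

/-- The `i`-th key (`i < 4`) cut out of the key material at seed length `n`. [folklore] -/
def key (n : ℕ) (K : List Bool) (i : ℕ) : List Bool := (K.drop (i * Λ.keyPartLen n)).take (Λ.keyPartLen n)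

/-- The obfuscator's coins: the `coinLen n` seed bits after the key material. [cite: BitanskyPanethRosen2015, §5.2] -/
def coins (s : List Bool) : List Bool := (s.drop (4 * Λ.keyPartLen s.length)).take (Λ.coinLen s.length)

/-- The naming `ν_K` of the instance with key material `K` (keys `k₁ = key 0`, `k₂ = key 1`).
[cite: ChildsEtAl2003, §2] -/
def namingOf (n : ℕ) (K : List Bool) : Vertex (Λ.depth n) ↪ (Fin (Λ.N n) → Bool) :=
  naming P (Λ.prfParam n) (Λ.key n K 0) (Λ.key n K 1) (Λ.depth n)

/-- The cycle datum `σ_K` of the instance (keys `k₃ = key 2`, `k₄ = key 3`). [cite: ChildsEtAl2003, §2] -/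
def cycleOfKey (n : ℕ) (K : List Bool) : CycleDatum (Λ.depth n) :=
  cycleOf P (Λ.prfParam n) (Λ.key n K 2) (Λ.key n K 3) (Λ.depth n)

/-- The neighbour predicate `N_K` of the instance (the function `circ n K` must compute).
[cite: ChildsEtAl2003, §2 and §4 Game 1] -/
def nbrBitOf (n : ℕ) (K : List Bool) : (Fin (Λ.N n + Λ.N n) → Bool) → Bool :=
  nbrBit (Λ.cycleOfKey P n K) (Λ.namingOf P n K)

/-- The name of a vertex of the instance. [cite: ChildsEtAl2003, §2] -/
def nameOfVertex (n : ℕ) (K : List Bool) (v : Vertex (Λ.depth n)) : List Bool :=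
  vname P (Λ.prfParam n) (Λ.key n K 0) (Λ.key n K 1) (Λ.depth n) v

/-- `name_K(ENTRANCE)`. [cite: ChildsEtAl2003, §2] -/
def entranceName (n : ℕ) (K : List Bool) : List Bool := Λ.nameOfVertex P n K (entrance _)

/-- `name_K(EXIT)`. [cite: ChildsEtAl2003, §2] -/
def exitName (n : ℕ) (K : List Bool) : List Bool := Λ.nameOfVertex P n K (exit _)

/-- Names of the instance have length `N n`. [folklore] -/
@[simp] theorem length_nameOfVertex (n : ℕ) (K : List Bool) (v : Vertex (Λ.depth n)) :
    (Λ.nameOfVertex P n K v).length = Λ.N n :=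
  length_vname _ _ _ _ _ _

/-- `|name_K(ENTRANCE)| = N n`. [folklore] -/
@[simp] theorem length_entranceName (n : ℕ) (K : List Bool) : (Λ.entranceName P n K).length = Λ.N n :=
  length_vname _ _ _ _ _ _

/-- `|name_K(EXIT)| = N n`. [folklore] -/
@[simp] theorem length_exitName (n : ℕ) (K : List Bool) : (Λ.exitName P n K).length = Λ.N n :=
  length_vname _ _ _ _ _ _

/-- `name(EXIT) ≠ name(ENTRANCE)` (distinct vertices, injective naming). [folklore] -/
theorem exitName_ne_entranceName (n : ℕ) (K : List Bool) : Λ.exitName P n K ≠ Λ.entranceName P n K :=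
  fun h => (entrance_ne_exit _).symm (vname_injective P _ _ _ _ h)

/-- The obfuscated instance circuit `O(κ, circ n K; r)` as a sized circuit on `2N` inputs.
[cite: BitanskyPanethRosen2015, §5.2] -/
def instCircuit (n : ℕ) (K r : List Bool) : SizedCircuit :=
  ⟨Λ.N n + Λ.N n, O.obf (Λ.secParam n) (Λ.circ n K) r⟩

end Params

/-- **The instance generator** `gen s = ⟨code of O(κ, N_K; r), name_K(ENTRANCE)⟩`: the seed
`s ∈ {0,1}ⁿ` is cut into the key material `K` (four keys) and the obfuscator's coins `r`; the
instance is the Boolean code of the obfuscated neighbour circuit paired with the name of the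
ENTRANCE. (The shape `genObf` of the route's line `knowledge-of-walk-split`, with a computable coin
schedule.) [cite: BitanskyPanethRosen2015, §5.2 (sampling a hard instance: keys, obfuscate the program)] -/
def gen (s : List Bool) : List Bool :=
  boolPair (encodeSizedCircuit (Λ.instCircuit O s.length (Λ.keyMaterial s) (Λ.coins s)))
    (Λ.entranceName P s.length (Λ.keyMaterial s))

/-- **The planted answer** `ans s = name_K(EXIT)`, zero-padded to the length of the instance
(so that `|ans s| = p(|gen s|)` with `p = X`). [cite: ChildsEtAl2003, §2 ("find the name of the EXIT")] -/
def ans (s : List Bool) : List Bool :=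
  fit (gen Λ O P s).length (Λ.exitName P s.length (Λ.keyMaterial s))

/-- `|ans s| = |gen s|`. [folklore] -/
@[simp] theorem length_ans (s : List Bool) : (ans Λ O P s).length = (gen Λ O P s).length :=
  length_fit _ _

/-- The length clause of `WbwThesis` for the pair: `|ans s| = p(|gen s|)` with `p = X`. [folklore] -/
theorem exists_poly_length_ans :
    ∃ p : Polynomial ℕ, ∀ s, (ans Λ O P s).length = p.eval (gen Λ O P s).length :=
  ⟨Polynomial.X, fun s => by simp⟩

/-- The instance is at least as long as a name. [folklore] -/
theorem N_le_length_gen (s : List Bool) : Λ.N s.length ≤ (gen Λ O P s).length := by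
  simp only [gen, length_boolPair, Params.length_entranceName]
  omega

/-- The answer is `name_K(EXIT)` followed by zeros. [folklore] -/
theorem ans_eq (s : List Bool) :
    ans Λ O P s = Λ.exitName P s.length (Λ.keyMaterial s) ++
      List.replicate ((gen Λ O P s).length - Λ.N s.length) false := by
  rw [ans, fit_eq_append_of_le (by simpa using N_le_length_gen Λ O P s)]
  simp

/-- `name_K(EXIT)` is a prefix of the answer. [folklore] -/
theorem exitName_prefix_ans (s : List Bool) : Λ.exitName P s.length (Λ.keyMaterial s) <+: ans Λ O P s := by
  rw [ans_eq]; exact List.prefix_append _ _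

/-- Outputs with the answer as a prefix have `name_K(EXIT)` as a prefix: the success event of
clause (C) for `ans` is contained in "the EXIT's name was output". [folklore] -/
theorem setOf_ans_prefix_subset (s : List Bool) :
    {y : List Bool | ans Λ O P s <+: y} ⊆ {y | Λ.exitName P s.length (Λ.keyMaterial s) <+: y} :=
  fun _ hy => (exitName_prefix_ans Λ O P s).trans hy

/-- The answer is never empty (it has at least the `N ≥ 3` bits of a name): the `ans = []` trap
is excluded on EVERY seed. [folklore] -/
theorem ans_ne_nil (s : List Bool) : ans Λ O P s ≠ [] := by
  intro h
  have h1 := congrArg List.length h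
  rw [length_ans] at h1
  have h2 := N_le_length_gen Λ O P s
  simp only [List.length_nil] at h1
  rw [h1] at h2
  simp [Params.N, nameLen, labelLen] at h2

end Generator

/-! ## §7 Functionality: what the instance's circuit computes -/

section Functionality

variable (Λ : Params) (O : CircuitObfuscator) (P : PuncturablePRFScheme)

/-- `CircCorrect Λ P`: the circuit presentation `Λ.circ n K` computes the neighbour predicate
`N_K` of the instance, for every seed length and key material. A requirement on the datum `Λ`
(non-vacuous: `circCorrect_canonical`), not a fact. [folklore] -/
def CircCorrect (Λ : Params) (P : PuncturablePRFScheme) : Prop :=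
  ∀ (n : ℕ) (K : List Bool) (x : Fin (Λ.N n + Λ.N n) → Bool), (Λ.circ n K).eval x = Λ.nbrBitOf P n K x

/-- The parameters with the circuit presentation replaced by the tabulating one-gate circuit.
[folklore] -/
def Params.canonical (Λ : Params) (P : PuncturablePRFScheme) : Params :=
  { Λ with circ := fun n K => truthTableCircuit (nbrBit
      (cycleOf P (Λ.prfParam n) ((K.drop (2 * Λ.keyPartLen n)).take (Λ.keyPartLen n))
        ((K.drop (3 * Λ.keyPartLen n)).take (Λ.keyPartLen n)) (Λ.depth n))
      (naming P (Λ.prfParam n) ((K.drop (0 * Λ.keyPartLen n)).take (Λ.keyPartLen n))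
        ((K.drop (1 * Λ.keyPartLen n)).take (Λ.keyPartLen n)) (Λ.depth n))) }

/-- **Non-vacuity of `CircCorrect`**: the tabulating presentation is correct. [folklore] -/
theorem circCorrect_canonical : CircCorrect (Λ.canonical P) P := by
  intro n K x
  simp only [Params.canonical, eval_truthTableCircuit]
  rfl

/-- `ObfPreservesAt Λ O s`: the obfuscator preserves the functionality of the instance circuit of
seed `s` at the coins actually used (pointwise form of the tree's `PreservesFunctionality`, which
gives it whenever `⟨2N, circ n K⟩` lies in the obfuscated class and `|coins| = O.coins κ _`).
A hypothesis, never a fact. [cite: BarakEtAl2012, Def. 2.2 (functionality)] -/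
def ObfPreservesAt (Λ : Params) (O : CircuitObfuscator) (s : List Bool) : Prop :=
  ∀ x, (O.obf (Λ.secParam s.length) (Λ.circ s.length (Λ.keyMaterial s)) (Λ.coins s)).eval x =
    (Λ.circ s.length (Λ.keyMaterial s)).eval x

/-- The tree's `PreservesFunctionality` yields `ObfPreservesAt` whenever the instance circuit lies
in the obfuscated class and the coin schedule is the obfuscator's coin count.
[cite: BarakEtAl2012, Def. 2.2 (functionality)] -/
theorem obfPreservesAt_of_preservesFunctionality {𝒞 : ℕ → Set SizedCircuit}
    (hO : O.PreservesFunctionality 𝒞) (s : List Bool)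
    (hmem : (⟨_, Λ.circ s.length (Λ.keyMaterial s)⟩ : SizedCircuit) ∈ 𝒞 (Λ.secParam s.length))
    (hcoins : (Λ.coins s).length = O.coins (Λ.secParam s.length) (Λ.circ s.length (Λ.keyMaterial s))) :
    ObfPreservesAt Λ O s := by
  have h := (O.preservesFunctionality_iff 𝒞).1 hO _ _ _ hmem (Λ.coins s) hcoins
  exact fun x => h.2 x

/-- **What the instance computes.** Under `CircCorrect` and functionality of the obfuscator at the
instance, the circuit shipped in `gen s`, queried at a name `a` and an output position given by its
binary digits `b` (inputs `Fin.append a b`), returns bit `nameVal b` of the answer string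
`answerBits σ_K ν_K a` — the `2`-bit neighbour count followed by the names of the neighbours, in
the graph `GluedTrees.graph d σ_K`, of the vertex named `a` under the naming `ν_K`, in the canonical
sorted order of the tree's `gluedTreesOracle σ_K ν_K a`, and the invalid answer for strings naming no
vertex. [cite: ChildsEtAl2003, §2 and §4 Game 1] -/
theorem eval_instCircuit (hcirc : CircCorrect Λ P) (s : List Bool) (hO : ObfPreservesAt Λ O s)
    (a b : Fin (Λ.N s.length) → Bool) :
    (Λ.instCircuit O s.length (Λ.keyMaterial s) (Λ.coins s)).2.eval (Fin.append a b) =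
      (answerBits (Λ.cycleOfKey P s.length (Λ.keyMaterial s)) (Λ.namingOf P s.length (Λ.keyMaterial s)) a).getD
        (nameVal b) false := by
  change (O.obf _ _ _).eval _ = _
  rw [hO (Fin.append a b), hcirc]
  simp only [Params.nbrBitOf, nbrBit, Fin.append_left, Fin.append_right]

/-! ### Reading an answer string back -/

/-- The neighbour count read off the first two bits of an answer string. [folklore] -/
def ansCount (w : List Bool) : ℕ := (w.getD 0 false).toNat + 2 * (w.getD 1 false).toNat

/-- **Decoding an answer string** into its list of `N`-bit names (at most three): the inverse
reading of `answerBits` (`decodeAnswer_answerBits`), i.e. how a walker parses the circuit's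
answers. [cite: ChildsEtAl2003, §2] -/
def decodeAnswer (N : ℕ) (w : List Bool) : List (Fin N → Bool) :=
  List.ofFn (n := min (ansCount w) 3) fun j => fun i => w.getD (2 + (j : ℕ) * N + i) false

/-- The flattened name list has length `|L| · N`. [folklore] -/
theorem length_flatten_map_ofFn {N : ℕ} (L : List (Fin N → Bool)) :
    ((L.map List.ofFn).flatten).length = L.length * N := by
  induction L with
  | nil => simp
  | cons l L ih => simp [List.flatten_cons, ih]; ring

/-- Indexing into the flattened name list: position `jN + i` is bit `i` of the `j`-th name.
[folklore] -/
theorem getD_flatten_map_ofFn {N : ℕ} (L : List (Fin N → Bool)) (rest : List Bool) (j i : ℕ)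
    (hi : i < N) (hj : j < L.length) :
    ((L.map List.ofFn).flatten ++ rest).getD (j * N + i) false = (L[j]'hj) ⟨i, hi⟩ := by
  induction L generalizing j with
  | nil => simp at hj
  | cons l L ih =>
    rw [List.map_cons, List.flatten_cons, List.append_assoc]
    cases j with
    | zero =>
      rw [Nat.zero_mul, Nat.zero_add, List.getD_append _ _ _ _ (by simpa using hi)]
      simp [hi]
    | succ j =>
      have hlen : (List.ofFn l).length ≤ (j + 1) * N + i := by
        simp [Nat.succ_mul]; omega
      rw [List.getD_append_right _ _ _ _ hlen, List.length_ofFn,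
        show (j + 1) * N + i - N = j * N + i by rw [Nat.succ_mul]; omega]
      simpa using ih j (by simpa using hj)

/-- **The answer string determines the neighbour list**: decoding `answerBits σ ν a` returns the
tree's `gluedTreesOracle σ ν a` (`1 ≤ d`, so that at most three names are listed).
[cite: ChildsEtAl2003, §2 and §4 Game 1] -/
theorem decodeAnswer_answerBits {d N : ℕ} (hd : 1 ≤ d) (σ : CycleDatum d) (ν : Vertex d ↪ (Fin N → Bool))
    (a : Fin N → Bool) : decodeAnswer N (answerBits σ ν a) = gluedTreesOracle σ ν a := by
  set L := gluedTreesOracle σ ν a with hL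
  have h3 : L.length ≤ 3 := length_gluedTreesOracle_le hd σ ν a
  have hlen : (bitsOf 2 L.length ++ (L.map List.ofFn).flatten).length ≤ ansLen N := by
    rw [List.length_append, length_bitsOf, length_flatten_map_ofFn, ansLen]
    nlinarith
  have hw : answerBits σ ν a = bitsOf 2 L.length ++ ((L.map List.ofFn).flatten ++
      List.replicate (ansLen N - (bitsOf 2 L.length ++ (L.map List.ofFn).flatten).length) false) := by
    rw [answerBits, ← hL, fit_eq_append_of_le hlen, List.append_assoc]
  -- the count
  have hcount : ansCount (answerBits σ ν a) = L.length := by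
    rw [hw, ansCount, List.getD_append _ _ _ _ (by simp), List.getD_append _ _ _ _ (by simp)]
    have : L.length = 0 ∨ L.length = 1 ∨ L.length = 2 ∨ L.length = 3 := by omega
    rcases this with h | h | h | h <;> rw [h] <;> simp [bitsOf, List.getD_eq_getElem?_getD] <;> decide
  -- the names
  apply List.ext_getElem
  · simp [decodeAnswer, hcount, min_eq_left h3]
  intro j hj₁ hj₂
  simp only [decodeAnswer, List.getElem_ofFn]
  funext i
  rw [hw, show 2 + j * N + (i : ℕ) = (bitsOf 2 L.length).length + (j * N + i) by simp; ring,
    List.getD_append_right _ _ _ _ (Nat.le_add_right _ _), Nat.add_sub_cancel_left]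
  exact getD_flatten_map_ofFn L _ j i i.isLt hj₂

end Functionality

/-! ## §8 The generator is polynomial time (from typed `FP` data on the primitives) -/

section PolyTime

open CodeFP

variable (Λ : Params) (O : CircuitObfuscator) (P : PuncturablePRFScheme)

/-- **The polynomial-time data the generator is assembled from** (`CodeFP` = computed on codes by an
`FP` string function): the five schedules of `Λ` in unary, the circuit presentation on
`⟨1ⁿ, K⟩`, the PRF evaluation map of `P` on `⟨1^μ, ⟨k, x⟩⟩` (the code of `IsEfficientFamily`), and the
obfuscator's run map on `⟨⟨1^κ, code C⟩, r⟩` (the code of `CircuitObfuscator.IsEfficient`; its coin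
COUNT is not needed — the schedule `Λ.coinLen` is). Hypotheses, discharged by the route from
`O.IsEfficient` / `P.IsEfficient` (clocked total extensions) and its choice of `Λ`. [cite: AroraBarak2009, §1.3] -/
structure FPData (Λ : Params) (O : CircuitObfuscator) (P : PuncturablePRFScheme) : Prop where
  /-- `n ↦ d(n)` in unary. -/
  depth : CodeFP unE unE Λ.depth
  /-- `n ↦ μ(n)` in unary. -/
  prfParam : CodeFP unE unE Λ.prfParam
  /-- `n ↦ keyPartLen n` in unary. -/
  keyPartLen : CodeFP unE unE Λ.keyPartLen
  /-- `n ↦ κ(n)` in unary. -/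
  secParam : CodeFP unE unE Λ.secParam
  /-- `n ↦ coinLen n` in unary. -/
  coinLen : CodeFP unE unE Λ.coinLen
  /-- `(1ⁿ, K) ↦ code of ⟨2N, circ n K⟩`. -/
  circ : CodeFP (pairE unE strE) encodeSizedCircuit (fun p => (⟨_, Λ.circ p.1 p.2⟩ : SizedCircuit))
  /-- `(1^μ, k, x) ↦ PRF_k(x)` at parameter `μ`. -/
  prfEval : CodeFP (pairE unE (pairE strE strE)) strE (fun p => P.eval p.1 p.2.1 p.2.2)
  /-- `((1^κ, code C), r) ↦ code of O(κ, C; r)`. -/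
  obf : CodeFP (pairE (pairE unE encodeSizedCircuit) strE) encodeSizedCircuit
    (fun p => (⟨p.1.2.1, O.obf p.1.1 p.1.2.2 p.2⟩ : SizedCircuit))

namespace FPData

/-- `m ↦ 0^m` (zeros of a unary length). [folklore] -/
theorem zeros : CodeFP unE strE (fun m => List.replicate m false) :=
  (bitsToStr.comp ((replicateOf bitE).comp ((const unE false).pair (CodeFP.id unE)))).congr fun _ => rfl

/-- `(1^m, x) ↦ fit m x`. [folklore] -/
theorem fitFP : CodeFP (pairE unE strE) strE (fun p => fit p.1 p.2) :=
  (strTake.comp ((fst unE strE).pair (strAppend.comp ((snd unE strE).pair (zeros.comp (fst unE strE)))))).congr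
    fun _ => rfl

variable {Λ O P}

/-- `(1^μ, k, 1^m, x) ↦ prf P μ k m x`. [folklore] -/
theorem prfFP (h : FPData Λ O P) :
    CodeFP (pairE unE (pairE strE (pairE unE strE))) strE (fun p => prf P p.1 p.2.1 p.2.2.1 p.2.2.2) := by
  -- names for the four projections
  have pμ : CodeFP (pairE unE (pairE strE (pairE unE strE))) unE (fun p => p.1) := fst _ _
  have pk : CodeFP (pairE unE (pairE strE (pairE unE strE))) strE (fun p => p.2.1) := (snd _ _).fst'
  have pm : CodeFP (pairE unE (pairE strE (pairE unE strE))) unE (fun p => p.2.2.1) := (snd _ _).snd'.fst'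
  have px : CodeFP (pairE unE (pairE strE (pairE unE strE))) strE (fun p => p.2.2.2) := (snd _ _).snd'.snd'
  have hin : CodeFP (pairE unE (pairE strE (pairE unE strE))) strE (fun p => fit p.1 p.2.2.2) :=
    fitFP.comp (pμ.pair px)
  have hev : CodeFP (pairE unE (pairE strE (pairE unE strE))) strE
      (fun p => P.eval p.1 p.2.1 (fit p.1 p.2.2.2)) :=
    h.prfEval.comp (pμ.pair (pk.pair hin))
  exact (fitFP.comp (pm.pair hev)).congr fun _ => rfl

/-- The label of the ENTRANCE is all zeros. [folklore] -/
theorem label_entrance (d : ℕ) : label d (entrance d) = List.replicate (labelLen d) false := by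
  have hb : bitsOf (d + 1) 0 = List.replicate (d + 1) false := by
    simp [bitsOf, List.ofFn_const, List.replicate_succ]
  have h1 : label d (entrance d) = false :: (bitsOf (d + 1) 0 ++ bitsOf (d + 1) 0) := rfl
  rw [h1, hb, ← List.replicate_add, ← List.replicate_succ, labelLen]
  congr 1
  ring

/-- Masking zeros by a mask of the same length returns the mask. [folklore] -/
theorem bxor_replicate_false {m : ℕ} {y : List Bool} (hy : y.length = m) :
    bxor (List.replicate m false) y = y := by
  induction y generalizing m with
  | nil => simp [bxor]
  | cons b y ih =>
    cases m with
    | zero => simp at hy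
    | succ m =>
      simp only [List.length_cons, Nat.add_right_cancel_iff] at hy
      simp only [bxor, List.replicate_succ, List.zipWith_cons_cons, Bool.false_xor, List.cons.injEq, true_and]
      exact ih hy

/-- Closed form of `name_K(ENTRANCE)`: tag of the zero label, then the mask itself. [folklore] -/
theorem entranceName_eq (n : ℕ) (K : List Bool) :
    Λ.entranceName P n K =
      tag P (Λ.prfParam n) (Λ.key n K 0) (List.replicate (labelLen (Λ.depth n)) false) ++
        prf P (Λ.prfParam n) (Λ.key n K 1) (labelLen (Λ.depth n))
          (tag P (Λ.prfParam n) (Λ.key n K 0) (List.replicate (labelLen (Λ.depth n)) false)) := by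
  rw [Params.entranceName, Params.nameOfVertex, vname, label_entrance, sivEnc, List.length_replicate,
    bxor_replicate_false (length_prf _ _ _ _ _)]

/-- `n ↦ labelLen (d n) = 2 d(n) + 3` in unary. [folklore] -/
theorem labelLenFP (h : FPData Λ O P) : CodeFP unE unE (fun n => labelLen (Λ.depth n)) :=
  ((unSucc.comp (unSucc.comp (unSucc.comp ((unMulConst 2).comp h.depth))))).congr fun n => by
    simp [labelLen]

/-- `(1ⁿ, K) ↦ key n K i` for a fixed `i`. [folklore] -/
theorem keyFP (h : FPData Λ O P) (i : ℕ) : CodeFP (pairE unE strE) strE (fun p => Λ.key p.1 p.2 i) := by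
  have hkp : CodeFP (pairE unE strE) unE (fun p => Λ.keyPartLen p.1) := h.keyPartLen.comp (fst _ _)
  have hdrop : CodeFP (pairE unE strE) strE (fun p => p.2.drop (i * Λ.keyPartLen p.1)) :=
    strDrop.comp (((unMulConst i).comp hkp).pair (snd _ _))
  exact (strTake.comp (hkp.pair hdrop)).congr fun _ => rfl

/-- `(1ⁿ, K) ↦ name_K(ENTRANCE)`. [folklore] -/
theorem entranceNameFP (h : FPData Λ O P) : CodeFP (pairE unE strE) strE (fun p => Λ.entranceName P p.1 p.2) := by
  have hμ : CodeFP (pairE unE strE) unE (fun p => Λ.prfParam p.1) := h.prfParam.comp (fst _ _)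
  have hℓ : CodeFP (pairE unE strE) unE (fun p => labelLen (Λ.depth p.1)) := h.labelLenFP.comp (fst _ _)
  have hz : CodeFP (pairE unE strE) strE (fun p => List.replicate (labelLen (Λ.depth p.1)) false) :=
    zeros.comp hℓ
  -- the tag `prf P μ k₁ μ zeros`
  have htag : CodeFP (pairE unE strE) strE
      (fun p => tag P (Λ.prfParam p.1) (Λ.key p.1 p.2 0) (List.replicate (labelLen (Λ.depth p.1)) false)) :=
    (h.prfFP.comp (hμ.pair ((h.keyFP 0).pair (hμ.pair hz)))).congr fun _ => rfl
  -- the mask `prf P μ k₂ ℓ tag`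
  have hmask : CodeFP (pairE unE strE) strE
      (fun p => prf P (Λ.prfParam p.1) (Λ.key p.1 p.2 1) (labelLen (Λ.depth p.1))
        (tag P (Λ.prfParam p.1) (Λ.key p.1 p.2 0) (List.replicate (labelLen (Λ.depth p.1)) false))) :=
    h.prfFP.comp (hμ.pair ((h.keyFP 1).pair (hℓ.pair htag)))
  exact (strAppend.comp (htag.pair hmask)).congr fun p => (entranceName_eq (Λ := Λ) (P := P) p.1 p.2).symm

/-- `s ↦ (1^{|s|}, K(s))`. [folklore] -/
theorem keyMaterialFP (h : FPData Λ O P) : CodeFP strE (pairE unE strE) (fun s => (s.length, Λ.keyMaterial s)) := by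
  have hn : CodeFP strE unE List.length := strLength
  have hK : CodeFP strE strE (fun s => Λ.keyMaterial s) :=
    (strTake.comp ((((unMulConst 4).comp (h.keyPartLen.comp hn))).pair (CodeFP.id strE))).congr fun _ => rfl
  exact hn.pair hK

/-- `s ↦ coins(s)`. [folklore] -/
theorem coinsFP (h : FPData Λ O P) : CodeFP strE strE (fun s => Λ.coins s) := by
  have hn : CodeFP strE unE List.length := strLength
  have hdrop : CodeFP strE strE (fun s => s.drop (4 * Λ.keyPartLen s.length)) :=
    strDrop.comp ((((unMulConst 4).comp (h.keyPartLen.comp hn))).pair (CodeFP.id strE))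
  exact (strTake.comp ((h.coinLen.comp hn).pair hdrop)).congr fun _ => rfl

/-- `s ↦` the code of the obfuscated instance circuit. [folklore] -/
theorem instCircuitFP (h : FPData Λ O P) :
    CodeFP strE encodeSizedCircuit (fun s => Λ.instCircuit O s.length (Λ.keyMaterial s) (Λ.coins s)) := by
  have hκ : CodeFP strE unE (fun s => Λ.secParam s.length) := h.secParam.comp strLength
  -- (no type ascriptions with placeholders below: unifying a `Σ`-literal with a holed arity is slow)
  have hC := h.circ.comp h.keyMaterialFP
  have hargs := (hκ.pair hC).pair h.coinsFP
  refine (h.obf.comp hargs).congr fun s => ?_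
  rfl

/-- **`gen ∈ FP`** on codes: the instance generator is computed by a polynomial-time string
function. [cite: AroraBarak2009, §1.3] -/
theorem genCodeFP (h : FPData Λ O P) : CodeFP strE strE (gen Λ O P) := by
  have hcode : CodeFP strE strE (fun s => encodeSizedCircuit (Λ.instCircuit O s.length (Λ.keyMaterial s) (Λ.coins s))) :=
    h.instCircuitFP.recodeOut fun _ => rfl
  have hname : CodeFP strE strE (fun s => Λ.entranceName P s.length (Λ.keyMaterial s)) :=
    h.entranceNameFP.comp h.keyMaterialFP
  exact (hcode.pair hname).recodeOut fun _ => rfl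

/-- **The generator is polynomial-time computable** (the first conjunct of `WbwThesis` for the
pair), from the typed `FP` data. [cite: AroraBarak2009, §1.3] -/
theorem polyTimeComputable_gen (h : FPData Λ O P) :
    PolyTimeComputable (id : List Bool → List Bool) id (gen Λ O P) :=
  h.genCodeFP.polyTimeComputable

end FPData

end PolyTime

end ObfuscatedGluedTrees

/-! ## The notion, in the topic namespace -/

open ObfuscatedGluedTrees in
/-- **The obfuscated glued-trees generator** `obfuscatedGluedTreesGen Λ O P f c = (gen, ans)` in the
argument order of the route's `GenType`
(`CircuitObfuscator → PuncturablePRFScheme → (injective one-way f) → (exponent c) → (gen, ans)`):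
`gen s = ⟨code of O(κ, N_K; r), name_K(ENTRANCE)⟩`, `ans s = name_K(EXIT)` padded to `|gen s|`
(module docstring, §6). The object uses `O` and `P`; the injective one-way function `f` and the
exponent `c` enter only the SECURITY ARGUMENT of the crux (BPR15's hybrids) and the route's choice of
the schedules in `Λ`, and are accepted for type compatibility. [cite: BitanskyPanethRosen2015, §5.2 (sampling hard instances: keys, obfuscated program)] -/
def obfuscatedGluedTreesGen (Λ : Params) :
    CircuitObfuscator → PuncturablePRFScheme → (List Bool → List Bool) → ℕ →
      (List Bool → List Bool) × (List Bool → List Bool) :=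
  fun O P _ _ => (gen Λ O P, ans Λ O P)

open ObfuscatedGluedTrees in
/-- `(obfuscatedGluedTreesGen Λ O P f c).1 = gen Λ O P`. [folklore] -/
@[simp] theorem obfuscatedGluedTreesGen_fst (Λ : Params) (O : CircuitObfuscator) (P : PuncturablePRFScheme)
    (f : List Bool → List Bool) (c : ℕ) : (obfuscatedGluedTreesGen Λ O P f c).1 = gen Λ O P := rfl

open ObfuscatedGluedTrees in
/-- `(obfuscatedGluedTreesGen Λ O P f c).2 = ans Λ O P`. [folklore] -/
@[simp] theorem obfuscatedGluedTreesGen_snd (Λ : Params) (O : CircuitObfuscator) (P : PuncturablePRFScheme)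
    (f : List Bool → List Bool) (c : ℕ) : (obfuscatedGluedTreesGen Λ O P f c).2 = ans Λ O P := rfl

end Literature.Computability.Cryptography

end
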